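import Summits.AtomisticToContinuum.Crystallization.Theorems.ChargedEnergyGapMemberValues
import Summits.AtomisticToContinuum.Crystallization.Theorems.ChargedEnergyGapMarginWalk
import HarnessLib

/-!
# Charged energy gap — lens-3 g65, node «BarlowRef» (R3) — part 28c «BlockSets»: the canonical blocks of a bulk pair

Line `stmt-AtomisticToContinuum-14231`, item 4 of the residual of record (the tube block EXHIBITION, part 25).  The CANONICAL, choice-free
block of a pair `(y, z)` at the record dials `(ϱχ, ϱ) = (80, 160)`:

* `Pay` — a paying site (`q ∈ P.points`, `q ∉ X`, `χ_σ(q)·w(q) > 0`);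
* `holeSet y z` — the excised sites within `81/100` of a point of the segment having a paying site within `20` (case H);
* `tStar y z = sInf (criticalSet C D σ 140 60 60 y z ∩ [0, 1])`, `pStar y z = y + tStar•(z − y)` — the first critical point of the margins
  (level `140`, listed distances `60`), part 28b; `ballSet y z` — the sites within `1881/100` of `pStar` (case W/D: an `18`-ball about a site
  within `81/100` of `pStar`, enlarged by the covering radius);
* `blkSet y z` — `holeSet` if non-empty, else `ballSet`; finite; `blk hsep y z` its Finset; `band X c` — `true` on `X` (hole band), `false` off
  `X` (uncored band `U`).

All of it is EQUIVARIANT under the period lattice (`blk_add`, `band_add`) because the level, the listed distances, `X` and `P.points` are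
periodic — no choice is made anywhere.  ELEMENTARY · PROVED, 0 sorry.
-/

noncomputable section

open scoped Classical

open Literature.MathematicalPhysics.StatisticalMechanics Literature.Geometry.DiscreteGeometry
open Summit.AtomisticToContinuum.Crystallization.Theses.PricedLinkCensus
open Summit.AtomisticToContinuum.Crystallization.Theorems.ChargedEnergyGapNegative

namespace Summit.AtomisticToContinuum.Crystallization.Theorems.ChargedEnergyGapChartDial

section BlockSets

variable (P : PeriodicConfiguration 3) (X C : Set E3) {m : ℕ} (D : Fin m → Set E3) (σ : Fin m → Bool)

/-- A PAYING SITE at the record dials: a non-excised site of positive paying weight `χ_σ·w`. -/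
def Pay (q : E3) : Prop :=
  q ∈ P.points ∧ q ∉ X ∧ 0 < localFactor 80 D σ q * profileWeight 160 C q

/-- The HOLE CANDIDATES of the pair `(y, z)`: excised sites within `81/100` of a point of the segment that have a paying site within `20`. -/
def holeSet (y z : E3) : Set E3 :=
  {c | c ∈ P.points ∧ c ∈ X ∧ (∃ t : ℝ, 0 ≤ t ∧ t ≤ 1 ∧ dist c (y + t • (z - y)) ≤ 81 / 100) ∧ ∃ q, Pay P X C D σ q ∧ dist q c ≤ 20}

/-- The FIRST CRITICAL PARAMETER of the pair: level `140` or a listed distance `60` is reached (part 28b). -/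
def tStar (y z : E3) : ℝ :=
  sInf (criticalSet C D σ 140 60 60 y z ∩ Set.Icc 0 1)

/-- The first critical POINT `y + t⋆•(z − y)`. -/
def pStar (y z : E3) : E3 :=
  y + tStar C D σ y z • (z - y)

/-- The BALL CANDIDATES: the sites within `1881/100` of the first critical point. -/
def ballSet (y z : E3) : Set E3 :=
  {c | c ∈ P.points ∧ dist c (pStar C D σ y z) ≤ 1881 / 100}

/-- The BLOCK of the pair as a set: the hole candidates if there are any, else the ball candidates. -/
def blkSet (y z : E3) : Set E3 :=
  if (holeSet P X C D σ y z).Nonempty then holeSet P X C D σ y z else ballSet P C D σ y z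

/-- The BAND of a site: `true` (hole band, clearance `40`, rate `5·10⁷`) on `X`, `false` (uncored band `U`, clearance `60`, rate `1/2100`) off `X`. -/
def band (c : E3) : Bool :=
  if c ∈ X then true else false

variable {P X C D σ}

/-! ### Elementary facts -/

/-- A point of the parametrised segment is within `dist y z` of `y` … [formal bookkeeping] -/
theorem dist_linePath_left {y z : E3} {t : ℝ} (h0 : 0 ≤ t) (h1 : t ≤ 1) : dist (y + t • (z - y)) y ≤ dist y z := by
  rw [dist_eq_norm, add_sub_cancel_left, norm_smul, Real.norm_eq_abs, abs_of_nonneg h0, dist_eq_norm, ← norm_neg (y - z), neg_sub]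
  exact (mul_le_of_le_one_left (norm_nonneg _) h1)

/-- … and lies on the segment. [formal bookkeeping] -/
theorem linePath_mem_segment {y z : E3} {t : ℝ} (h0 : 0 ≤ t) (h1 : t ≤ 1) : y + t • (z - y) ∈ segment ℝ y z := by
  rw [segment_eq_image']
  exact ⟨t, ⟨h0, h1⟩, rfl⟩

/-- The hole candidates lie in a ball about `y`. -/
theorem holeSet_subset (y z : E3) : holeSet P X C D σ y z ⊆ P.points ∩ Metric.closedBall y (dist y z + 81 / 100) := by
  rintro c ⟨hc, -, ⟨t, h0, h1, hd⟩, -⟩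
  refine ⟨hc, Metric.mem_closedBall.2 ?_⟩
  calc dist c y ≤ dist c (y + t • (z - y)) + dist (y + t • (z - y)) y := dist_triangle _ _ _
    _ ≤ 81 / 100 + dist y z := add_le_add hd (dist_linePath_left h0 h1)
    _ = dist y z + 81 / 100 := add_comm _ _

/-- The ball candidates lie in a ball about `pStar`. -/
theorem ballSet_subset (y z : E3) : ballSet P C D σ y z ⊆ P.points ∩ Metric.closedBall (pStar C D σ y z) (1881 / 100) :=
  fun _ hc => ⟨hc.1, Metric.mem_closedBall.2 hc.2⟩

/-- The block set is finite (separated points in a ball). -/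
theorem blkSet_finite (hsep : IsSeparatedRef (3 / 5) P) (y z : E3) : (blkSet P X C D σ y z).Finite := by
  unfold blkSet
  split_ifs
  · exact (hsep.finite_inter_closedBall (by norm_num) y _).subset (holeSet_subset y z)
  · exact (hsep.finite_inter_closedBall (by norm_num) _ _).subset (ballSet_subset y z)

/-- The block set consists of sites. -/
theorem blkSet_subset_points (y z : E3) : blkSet P X C D σ y z ⊆ P.points := by
  unfold blkSet
  split_ifs
  · exact fun c hc => hc.1
  · exact fun c hc => hc.1

variable (P X C D σ) in
/-- The BLOCK of the pair `(y, z)` as a Finset. -/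
def blk (hsep : IsSeparatedRef (3 / 5) P) (y z : E3) : Finset E3 :=
  (blkSet_finite (X := X) (C := C) (D := D) (σ := σ) hsep y z).toFinset

/-- Membership in the block. [formal bookkeeping] -/
theorem mem_blk {hsep : IsSeparatedRef (3 / 5) P} {y z c : E3} : c ∈ blk P X C D σ hsep y z ↔ c ∈ blkSet P X C D σ y z :=
  Set.Finite.mem_toFinset _

/-- `tStar ∈ [0, 1]` always (the infimum of a subset of `[0, 1]`, or `0`). -/
theorem tStar_mem_Icc (y z : E3) : tStar C D σ y z ∈ Set.Icc (0 : ℝ) 1 := by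
  unfold tStar
  by_cases hne : (criticalSet C D σ 140 60 60 y z ∩ Set.Icc 0 1).Nonempty
  · have hbdd : BddBelow (criticalSet C D σ 140 60 60 y z ∩ Set.Icc 0 1) := ⟨0, fun t ht => ht.2.1⟩
    obtain ⟨t, ht⟩ := hne
    exact ⟨le_csInf ⟨t, ht⟩ fun u hu => hu.2.1, (csInf_le hbdd ht).trans ht.2.2⟩
  · rw [Set.not_nonempty_iff_eq_empty.1 hne, Real.sInf_empty]
    exact ⟨le_rfl, zero_le_one⟩

/-- `pStar` lies on the segment. -/
theorem pStar_mem_segment (y z : E3) : pStar C D σ y z ∈ segment ℝ y z :=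
  linePath_mem_segment (tStar_mem_Icc y z).1 (tStar_mem_Icc y z).2

/-! ### Periodicity -/

section Periodic

variable {g : E3}

/-- Paying is periodic. -/
theorem pay_add_iff (hX : IsInvariantSet P X) (hC : IsInvariantSet P C) (hD : ∀ i, IsInvariantSet P (D i)) (σ : Fin m → Bool)
    (hg : g ∈ P.lattice) (q : E3) : Pay P X C D σ (q + g) ↔ Pay P X C D σ q := by
  unfold Pay
  rw [hX g hg q, localFactor_add_of_isInvariantSet 80 hD σ hg, profileWeight_add_of_isInvariantSet 160 hC hg]
  constructor
  · rintro ⟨hq, h2, h3⟩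
    exact ⟨by simpa using P.add_mem_points hq (P.lattice.neg_mem hg), h2, h3⟩
  · rintro ⟨hq, h2, h3⟩
    exact ⟨P.add_mem_points hq hg, h2, h3⟩

/-- … in the subtractive form. -/
theorem pay_sub_iff (hX : IsInvariantSet P X) (hC : IsInvariantSet P C) (hD : ∀ i, IsInvariantSet P (D i)) (σ : Fin m → Bool)
    (hg : g ∈ P.lattice) (q : E3) : Pay P X C D σ (q - g) ↔ Pay P X C D σ q := by
  have h := pay_add_iff hX hC hD σ hg (q - g)
  rw [sub_add_cancel] at h
  exact h.symm

/-- The translated path. [formal bookkeeping] -/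
theorem linePath_add (y z g : E3) (t : ℝ) : (y + g) + t • ((z + g) - (y + g)) = (y + t • (z - y)) + g := by
  rw [add_sub_add_right_eq_sub]
  abel

/-- Sites are periodic, subtractive form. [formal bookkeeping] -/
theorem sub_mem_points_iff (hg : g ∈ P.lattice) (c : E3) : c - g ∈ P.points ↔ c ∈ P.points :=
  ⟨fun h => by simpa using P.add_mem_points h hg, fun h => by simpa [sub_eq_add_neg] using P.add_mem_points h (P.lattice.neg_mem hg)⟩

/-- `X` is periodic, subtractive form. [formal bookkeeping] -/
theorem sub_mem_X_iff (hX : IsInvariantSet P X) (hg : g ∈ P.lattice) (c : E3) : c - g ∈ X ↔ c ∈ X := by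
  have h := hX g hg (c - g)
  rw [sub_add_cancel] at h
  exact h.symm

/-- The hole candidates are equivariant. -/
theorem mem_holeSet_add_iff (hX : IsInvariantSet P X) (hC : IsInvariantSet P C) (hD : ∀ i, IsInvariantSet P (D i)) (σ : Fin m → Bool)
    (hg : g ∈ P.lattice) (y z c : E3) : c ∈ holeSet P X C D σ (y + g) (z + g) ↔ c - g ∈ holeSet P X C D σ y z := by
  simp only [holeSet, Set.mem_setOf_eq, linePath_add, sub_mem_points_iff hg, sub_mem_X_iff hX hg]
  have hdist : ∀ p : E3, dist (c - g) p = dist c (p + g) := fun p => by rw [← dist_add_right (c - g) p g, sub_add_cancel]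
  simp only [hdist]
  constructor
  · rintro ⟨h1, h2, h3, q, hq, hqc⟩
    exact ⟨h1, h2, h3, q - g, (pay_sub_iff hX hC hD σ hg q).2 hq, by rwa [dist_sub_right]⟩
  · rintro ⟨h1, h2, h3, q, hq, hqc⟩
    refine ⟨h1, h2, h3, q + g, (pay_add_iff hX hC hD σ hg q).2 hq, ?_⟩
    rwa [← dist_add_right q (c - g) g, sub_add_cancel] at hqc

/-- The critical set is invariant. -/
theorem criticalSet_add (hC : IsInvariantSet P C) (hD : ∀ i, IsInvariantSet P (D i)) (σ : Fin m → Bool) (hg : g ∈ P.lattice) (L a b : ℝ)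
    (y z : E3) : criticalSet C D σ L a b (y + g) (z + g) = criticalSet C D σ L a b y z := by
  have hDg : ∀ i (q : E3), Metric.infDist (q + g) (D i) = Metric.infDist q (D i) := fun i q => (hD i).infDist_add hg q
  ext t
  simp only [criticalSet, Set.mem_setOf_eq, linePath_add, hC.infDist_add hg, hDg]

/-- `tStar` is invariant … -/
theorem tStar_add (hC : IsInvariantSet P C) (hD : ∀ i, IsInvariantSet P (D i)) (σ : Fin m → Bool) (hg : g ∈ P.lattice) (y z : E3) :
    tStar C D σ (y + g) (z + g) = tStar C D σ y z := by
  unfold tStar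
  rw [criticalSet_add hC hD σ hg]

/-- … and `pStar` is equivariant. -/
theorem pStar_add (hC : IsInvariantSet P C) (hD : ∀ i, IsInvariantSet P (D i)) (σ : Fin m → Bool) (hg : g ∈ P.lattice) (y z : E3) :
    pStar C D σ (y + g) (z + g) = pStar C D σ y z + g := by
  unfold pStar
  rw [tStar_add hC hD σ hg, linePath_add]

/-- The ball candidates are equivariant. -/
theorem mem_ballSet_add_iff (hC : IsInvariantSet P C) (hD : ∀ i, IsInvariantSet P (D i)) (σ : Fin m → Bool) (hg : g ∈ P.lattice)
    (y z c : E3) : c ∈ ballSet P C D σ (y + g) (z + g) ↔ c - g ∈ ballSet P C D σ y z := by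
  simp only [ballSet, Set.mem_setOf_eq, pStar_add hC hD σ hg, sub_mem_points_iff hg]
  rw [← dist_add_right (c - g) _ g, sub_add_cancel]

/-- The block set is equivariant. -/
theorem mem_blkSet_add_iff (hX : IsInvariantSet P X) (hC : IsInvariantSet P C) (hD : ∀ i, IsInvariantSet P (D i)) (σ : Fin m → Bool)
    (hg : g ∈ P.lattice) (y z c : E3) : c ∈ blkSet P X C D σ (y + g) (z + g) ↔ c - g ∈ blkSet P X C D σ y z := by
  have hne : (holeSet P X C D σ (y + g) (z + g)).Nonempty ↔ (holeSet P X C D σ y z).Nonempty := by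
    constructor
    · rintro ⟨c', hc'⟩
      exact ⟨c' - g, (mem_holeSet_add_iff hX hC hD σ hg y z c').1 hc'⟩
    · rintro ⟨c', hc'⟩
      refine ⟨c' + g, (mem_holeSet_add_iff hX hC hD σ hg y z (c' + g)).2 ?_⟩
      rwa [add_sub_cancel_right]
  unfold blkSet
  by_cases h : (holeSet P X C D σ y z).Nonempty
  · rw [if_pos (hne.2 h), if_pos h]
    exact mem_holeSet_add_iff hX hC hD σ hg y z c
  · rw [if_neg (fun h' => h (hne.1 h')), if_neg h]
    exact mem_ballSet_add_iff hC hD σ hg y z c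

/-- ★ THE BLOCK IS EQUIVARIANT: `blk (y + g) (z + g) = (blk y z) + g`. -/
theorem blk_add (hX : IsInvariantSet P X) (hC : IsInvariantSet P C) (hD : ∀ i, IsInvariantSet P (D i)) (σ : Fin m → Bool)
    (hg : g ∈ P.lattice) (hsep : IsSeparatedRef (3 / 5) P) (y z : E3) :
    blk P X C D σ hsep (y + g) (z + g) = (blk P X C D σ hsep y z).image (· + g) := by
  ext c
  rw [mem_blk, Finset.mem_image, mem_blkSet_add_iff hX hC hD σ hg]
  constructor
  · intro h
    exact ⟨c - g, mem_blk.2 h, sub_add_cancel c g⟩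
  · rintro ⟨c', hc', rfl⟩
    rw [add_sub_cancel_right]
    exact mem_blk.1 hc'

/-- ★ THE BAND IS PERIODIC. -/
theorem band_add (hX : IsInvariantSet P X) (hg : g ∈ P.lattice) (c : E3) : band X (c + g) = band X c := by
  unfold band
  rw [show (c + g ∈ X) = (c ∈ X) from propext (hX g hg c)]

end Periodic

end BlockSets

end Summit.AtomisticToContinuum.Crystallization.Theorems.ChargedEnergyGapChartDial

end
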